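import Mathlib
import Summits.ValiantsHypothesis.ValiantsHypothesis.Theorems.KPlusLogSqLawLiftingLocalDescartesDominance
import Summits.ValiantsHypothesis.ValiantsHypothesis.Theorems.KPlusLogSqLawLiftingLocalDescartesSigns

/-!
# THE LOCAL DESCARTES RULE: between two archimedean dominance points a real polynomial has at most `Var(window)` zeros

HONEST FRAMING.  Helper file toward the lifting crux `WeakLifting` (stmt-ValiantsHypothesis-19561; aside `Lifting`
stmt-ValiantsHypothesis-19772, registered stub `stub_liftThin`) of route `KPlusLogSqLaw` (cell `pub-symmetroid`, seat
val-sym-lift-p1 g8, 2026-08-27).  Elementary facts about ONE real polynomial / real sequences; nothing here asserts `WeakLifting`,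
`TropicalB`, Conjecture B, `MatrixDescartes` (stmt-ValiantsHypothesis-18050) or anything about VP ≠ VNP.

THEOREM (`card_roots_Ioo_le_signVar_coeffs`).  Let `f = Σ c_i X^i` be a real polynomial, `0 < a < b`, and suppose the
monomial `x^u` dominates `f` at `a` (`Σ_{i ≠ u} |c_i| a^i < |c_u| a^u`) and `x^w` dominates `f` at `b`, `u ≤ w`.  Then the number
of distinct zeros of `f` in `(a, b)` is at most `Var(c_u, c_{u+1}, …, c_w)`, the number of sign changes of the WINDOW of
coefficients between the two dominant exponents.  This is Descartes' rule of signs localised to a dominance window; it answers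
the question (S-loc) of val-sym-lift-p4's GAP-LIFT §4 («local Descartes», numerically clean on 17 000 windows, sketch with a
hole) and extends the margin window of `…LiftingNewtonWindows` / `…LiftingExactPatchwork` (two vertex terms, at most ONE
zero) to arbitrary interior terms.  HONEST READING (GAP-LIFT §3 M1): summed over consecutive dominance windows it redistributes
the global Descartes count (`Σ_windows Var_local ≤ Var`), so by itself it cannot beat Descartes on a format; it is a pencil-level
tool.  PROOF: the two-point Laguerre rule (`card_roots_Ioo_le_signVar_twoPoint'`) bounds the count by `Var(E_0, …, E_{n+1})`;
dominance makes `E_j` share the sign of `c_u` for `j ≤ u` and of `c_w` for `j ≥ w` (`…LocalDescartesDominance`), and for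
`u ≤ j ≤ w` one has `E_j = a^j Ψ_j` with `Ψ` the partial sums of positive multiples of the tail sums of the LUMPED window sequence
`(c_u a^u + low junk, c_{u+1} a^{u+1}, …, c_w a^w + high junk)` whose end terms keep the signs of `c_u`, `c_w` by dominance;
the variation-diminishing lemmas of `…LocalDescartesSigns` give `Var(E_u..E_w) ≤ Var(c_u..c_w)`.  No `def`.
[folklore] (Laguerre's method; one-point rule [VanMieghem2010, art. 317, Thm 88]).
-/

set_option linter.dupNamespace false
set_option autoImplicit false

namespace Summit.ValiantsHypothesis.ValiantsHypothesis.Theorems.KPlusLogSqLaw.LocalDescartes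

open Set Finset
open scoped BigOperators
open Literature.Algebra.Polynomial (signVar signVarAux)
open Literature.Computability.AlgebraicComplexity.BD17 (signVar_cons_cons_of_ne_zero)
/-! ## The local Descartes rule -/

set_option maxHeartbeats 1000000 in
/-- **LOCAL DESCARTES RULE.**  Let `f = Σ c_i X^i` be a real polynomial and `0 < a < b`.  If the monomial `x^u` DOMINATES `f` at
`a` (`Σ_{i ≠ u} |c_i| a^i < |c_u| a^u`) and `x^w` dominates `f` at `b`, with `u ≤ w`, then the number of distinct zeros of
`f` in `(a, b)` is at most the number of sign changes of the WINDOW of coefficients `c_u, c_{u+1}, …, c_w` — Descartes' rule of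
signs localised between two archimedean dominance points (GAP-LIFT §4 (S-loc) of val-sym-lift-p4, there a question with a hole in
the sketch; summed over consecutive dominance windows it redistributes, never beats, the global Descartes count).  PROOF: the
two-point Laguerre rule (`card_roots_Ioo_le_signVar_twoPoint'`) bounds the count by `Var(E_0, …, E_{n+1})`; dominance at `a`
gives `E_j` the sign of `c_u` for `j ≤ u`, dominance at `b` the sign of `c_w` for `j ≥ w`; and on `u ≤ j ≤ w`,
`E_j = a^j Ψ_j` where `Ψ` is the sequence of partial sums of positive multiples of the tail sums of the window sequence
`c_u a^u + (lower junk), c_{u+1}a^{u+1}, …, c_w a^w + (upper junk)` (junk smaller than the end terms by dominance), so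
`Var(E_u..E_w) ≤ Var(c_u..c_w)` by the two variation-diminishing lemmas `signVar_partialSums_map_le`, `signVar_tailSums_map_le`.
[folklore] (Laguerre's method; the one-point rule is [VanMieghem2010, art. 317, Thm 88]) -/
theorem card_roots_Ioo_le_signVar_coeffs (f : Polynomial ℝ) {a b : ℝ} (ha : 0 < a) (hab : a < b) {u w : ℕ}
    (huw : u ≤ w)
    (hdomA : ∑ i ∈ f.support.erase u, |f.coeff i| * a ^ i < |f.coeff u| * a ^ u)
    (hdomB : ∑ i ∈ f.support.erase w, |f.coeff i| * b ^ i < |f.coeff w| * b ^ w) :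
    (f.roots.toFinset.filter (fun x => a < x ∧ x < b)).card ≤
      signVar ((List.range (w + 1 - u)).map (fun k => f.coeff (u + k))) := by
  classical
  have hb : 0 < b := ha.trans hab
  have hba : 1 < b / a := (one_lt_div ha).mpr hab
  have hba0 : 0 < b / a := lt_trans one_pos hba
  have hab1 : a / b < 1 := (div_lt_one hb).mpr hab
  have hab0 : 0 < a / b := div_pos ha hb
  have hcu : f.coeff u ≠ 0 := by
    intro h; rw [h, abs_zero, zero_mul] at hdomA
    exact absurd hdomA (not_lt.mpr (Finset.sum_nonneg fun i _ => mul_nonneg (abs_nonneg _) (pow_nonneg ha.le _)))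
  have hcw : f.coeff w ≠ 0 := by
    intro h; rw [h, abs_zero, zero_mul] at hdomB
    exact absurd hdomB (not_lt.mpr (Finset.sum_nonneg fun i _ => mul_nonneg (abs_nonneg _) (pow_nonneg hb.le _)))
  have hf : f ≠ 0 := fun h => hcu (by rw [h, Polynomial.coeff_zero])
  have hwn : w ≤ f.natDegree := Polynomial.le_natDegree_of_ne_zero hcw
  refine (card_roots_Ioo_le_signVar_twoPoint' f hf ha hab).trans ?_
  set n := f.natDegree with hn
  set E : ℕ → ℝ := fun j => b ^ j * (∑ i ∈ Finset.Icc j n, f.coeff i * a ^ i)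
    + a ^ j * (∑ i ∈ Finset.range j, f.coeff i * b ^ i) with hE
  have hEu : ∀ j, j ≤ u → 0 < f.coeff u * E j := fun j hj =>
    coeff_mul_twoPointEntry_pos_of_le f ha hab hj (le_trans huw hwn) hdomA
  have hEw : ∀ j, w ≤ j → j ≤ n + 1 → 0 < f.coeff w * E j := fun j hj hjn =>
    coeff_mul_twoPointEntry_pos_of_ge f ha hab hj hjn hdomB
  set m := w + 1 - u with hm
  have hm1 : 1 ≤ m := by omega
  ------------------------------------------------------------------ split `range (n+2)` into prefix, window, suffix
  have hsplit : (List.range (n + 2)).map E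
      = (List.range u).map E ++ ((List.range m).map (fun k => E (u + k)) ++ (List.range (n + 1 - w)).map (fun k => E (w + 1 + k))) := by
    have : n + 2 = u + (m + (n + 1 - w)) := by omega
    rw [this]
    simp only [List.range_add, List.map_append, List.map_map]
    refine congrArg₂ _ rfl (congrArg₂ _ (List.map_congr_left fun k _ => rfl) (List.map_congr_left fun k _ => ?_))
    simp only [Function.comp_apply]
    have hk : u + (m + k) = w + 1 + k := by omega
    rw [hk]
  rw [hsplit]
  ------------------------------------------------------------------ prefix: all entries have the sign of `E u`, the window's head
  have hwindow_cons : (List.range m).map (fun k => E (u + k)) = E u :: (List.range (m - 1)).map (fun k => E (u + 1 + k)) := by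
    have : m = (m - 1) + 1 := by omega
    rw [this, List.range_succ_eq_map, List.map_cons, List.map_map, add_zero]
    congr 1
    refine List.map_congr_left fun k _ => ?_
    simp only [Function.comp_apply]
    have hk : u + (k + 1) = u + 1 + k := by omega
    rw [hk]
  have hpre : signVar ((List.range u).map E ++ ((List.range m).map (fun k => E (u + k))
      ++ (List.range (n + 1 - w)).map (fun k => E (w + 1 + k))))
      = signVar ((List.range m).map (fun k => E (u + k)) ++ (List.range (n + 1 - w)).map (fun k => E (w + 1 + k))) := by
    rw [hwindow_cons, List.cons_append]
    refine signVar_prefix_same _ _ _ (fun x hx => ?_)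
    rw [List.mem_map] at hx
    obtain ⟨j, hj, rfl⟩ := hx
    have h1 := hEu j (List.mem_range.mp hj).le
    have h2 := hEu u le_rfl
    have : 0 < (f.coeff u * E j) * (f.coeff u * E u) := mul_pos h1 h2
    nlinarith [mul_self_nonneg (f.coeff u)]
  rw [hpre]
  ------------------------------------------------------------------ suffix: all entries have the sign of `E w`, the window's last
  have hwindow_snoc : (List.range m).map (fun k => E (u + k)) = (List.range (m - 1)).map (fun k => E (u + k)) ++ [E w] := by
    have : m = (m - 1) + 1 := by omega
    have huw' : u + (m - 1) = w := by omega
    rw [this, List.range_succ, List.map_append, List.map_singleton, Nat.add_sub_cancel, huw']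
  have hsuf : signVar ((List.range m).map (fun k => E (u + k)) ++ (List.range (n + 1 - w)).map (fun k => E (w + 1 + k)))
      = signVar ((List.range m).map (fun k => E (u + k))) := by
    rw [← signVar_reverse, List.reverse_append, hwindow_snoc, List.reverse_append, List.reverse_singleton,
      List.singleton_append]
    rw [signVar_prefix_same _ _ _ (fun x hx => ?_)]
    · rw [← signVar_reverse, List.reverse_cons, List.reverse_reverse]
    · rw [List.mem_reverse, List.mem_map] at hx
      obtain ⟨j, hj, rfl⟩ := hx
      have hj' := List.mem_range.mp hj
      have h1 := hEw (w + 1 + j) (by omega) (by omega)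
      have h2 := hEw w le_rfl (by omega)
      have : 0 < (f.coeff w * E (w + 1 + j)) * (f.coeff w * E w) := mul_pos h1 h2
      nlinarith [mul_self_nonneg (f.coeff w)]
  rw [hsuf]
  ------------------------------------------------------------------ the window: `E (u+k) = a^(u+k) Ψ (u+k)`
  set A : ℕ → ℝ := fun i => f.coeff i * a ^ i with hA
  set Lo : ℝ := ∑ i ∈ Finset.range u, A i * (b / a) ^ i with hLo
  set Hi : ℝ := ∑ i ∈ Finset.Ioc w n, A i with hHi
  -- lumped window sequence (absolute indices)
  set B : ℕ → ℝ := fun i => A i + (if i = u then Lo * (a / b) ^ u else 0) + (if i = w then Hi else 0) with hB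
  set TS : ℕ → ℝ := fun k => ∑ i ∈ Finset.Ico k m, B (u + i) with hTS
  set τ : ℕ → ℝ := fun k => if k = 0 then (b / a) ^ u * TS 0 else ((b / a) ^ (u + k) - (b / a) ^ (u + k - 1)) * TS k with hτ
  have hTS' : ∀ k, k < m → TS k = ∑ i ∈ Finset.Ico (u + k) (w + 1), B i := by
    intro k hk
    rw [hTS]; simp only
    rw [Finset.sum_Ico_add B k m u, add_comm k u]
    congr 2; omega
  -- (I1) `E j = a^j Ψ j`
  have hI1 : ∀ j, E j = a ^ j * ((b / a) ^ j * ∑ i ∈ Finset.Icc j n, A i + ∑ i ∈ Finset.range j, A i * (b / a) ^ i) := by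
    intro j
    rw [hE, hA]; simp only
    rw [mul_add, ← mul_assoc, ← mul_pow, mul_div_cancel₀ _ ha.ne', Finset.mul_sum, Finset.mul_sum (Finset.range j),
      Finset.mul_sum]
    congr 1
    refine Finset.sum_congr rfl fun i _ => ?_
    rw [div_pow]
    field_simp
  -- (I2) `Ψ j` through the lumped window, `u ≤ j ≤ w`
  have hI2 : ∀ j, u ≤ j → j ≤ w →
      (b / a) ^ j * ∑ i ∈ Finset.Icc j n, A i + ∑ i ∈ Finset.range j, A i * (b / a) ^ i
        = (b / a) ^ j * ∑ i ∈ Finset.Icc j w, B i + ∑ i ∈ Finset.Ico u j, B i * (b / a) ^ i := by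
    intro j huj hjw
    have hIcc : Finset.Icc j n = Finset.Icc j w ∪ Finset.Ioc w n := by
      ext i; simp [Finset.mem_Icc, Finset.mem_Ioc]; omega
    have hIccd : Disjoint (Finset.Icc j w) (Finset.Ioc w n) := by
      rw [Finset.disjoint_left]; intro i h1 h2; simp [Finset.mem_Icc, Finset.mem_Ioc] at h1 h2; omega
    have hrg : Finset.range j = Finset.range u ∪ Finset.Ico u j := by
      ext i; simp [Finset.mem_Ico]; omega
    have hrgd : Disjoint (Finset.range u) (Finset.Ico u j) := by
      rw [Finset.disjoint_left]; intro i h1 h2; simp [Finset.mem_Ico] at h1 h2; omega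
    rw [hIcc, Finset.sum_union hIccd, hrg, Finset.sum_union hrgd, ← hHi, ← hLo]
    -- expand `B`
    have h1 : (a / b) ^ u * (b / a) ^ u = 1 := by
      rw [← mul_pow, div_mul_div_comm, mul_comm a b, div_self (mul_pos hb ha).ne', one_pow]
    have eB1 : ∑ i ∈ Finset.Icc j w, B i
        = ∑ i ∈ Finset.Icc j w, A i + (if u ∈ Finset.Icc j w then Lo * (a / b) ^ u else 0) + Hi := by
      rw [hB]; simp only
      rw [Finset.sum_add_distrib, Finset.sum_add_distrib, Finset.sum_ite_eq', Finset.sum_ite_eq',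
        if_pos (Finset.mem_Icc.mpr ⟨hjw, le_rfl⟩)]
    have eB2 : ∑ i ∈ Finset.Ico u j, B i * (b / a) ^ i
        = ∑ i ∈ Finset.Ico u j, A i * (b / a) ^ i + (if u ∈ Finset.Ico u j then Lo * (a / b) ^ u * (b / a) ^ u else 0) := by
      rw [hB]; simp only
      simp only [add_mul, Finset.sum_add_distrib, ite_mul, zero_mul]
      rw [Finset.sum_ite_eq', Finset.sum_ite_eq']
      have hw : w ∉ Finset.Ico u j := by simp [Finset.mem_Ico]; omega
      rw [if_neg hw, add_zero]
    rw [eB1, eB2]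
    by_cases hju : j = u
    · have hmem : u ∈ Finset.Icc j w := Finset.mem_Icc.mpr ⟨by omega, huw⟩
      have hnmem : u ∉ Finset.Ico u j := by simp [Finset.mem_Ico]; omega
      rw [if_pos hmem, if_neg hnmem, hju]
      linear_combination (-Lo) * h1
    · have hnmem : u ∉ Finset.Icc j w := by simp [Finset.mem_Icc]; omega
      have hmem : u ∈ Finset.Ico u j := by simp [Finset.mem_Ico]; omega
      rw [if_neg hnmem, if_pos hmem]
      linear_combination (-Lo) * h1
  -- (I3) telescoping: partial sums of `τ`
  have hI3 : ∀ k, k < m → ∑ i ∈ Finset.range (k + 1), τ i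
      = (b / a) ^ (u + k) * TS k + ∑ i ∈ Finset.Ico u (u + k), B i * (b / a) ^ i := by
    intro k hk
    induction k with
    | zero => rw [hτ]; simp
    | succ k ih =>
      rw [Finset.sum_range_succ, ih (by omega), hτ]
      simp only [Nat.succ_ne_zero, if_false]
      rw [show u + (k + 1) - 1 = u + k by omega]
      have hsplit : TS k = B (u + k) + TS (k + 1) := by
        rw [hTS]; simp only
        rw [Finset.sum_eq_sum_Ico_succ_bot (by omega : k < m)]
      rw [show u + (k + 1) = u + k + 1 by ring, Finset.sum_Ico_succ_top (by omega : u ≤ u + k), hsplit]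
      ring
  have hΨ : ∀ k, k < m → E (u + k) = a ^ (u + k) * ∑ i ∈ Finset.range (k + 1), τ i := by
    intro k hk
    rw [hI1, hI2 (u + k) (by omega) (by omega), hI3 k hk, hTS' k hk]
    have hIcc : Finset.Icc (u + k) w = Finset.Ico (u + k) (w + 1) := by
      ext i; simp only [Finset.mem_Icc, Finset.mem_Ico]; omega
    rw [hIcc]
  have hmid : (List.range m).map (fun k => E (u + k)) = (List.range m).map (fun k => a ^ (u + k) * ∑ i ∈ Finset.range (k + 1), τ i) :=
    List.map_congr_left fun k hk => hΨ k (List.mem_range.mp hk)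
  rw [hmid]
  -- positive rescaling, partial sums, positive rescaling, tail sums, signs of the lumped window
  have step1 : signVar ((List.range m).map (fun k => a ^ (u + k) * ∑ i ∈ Finset.range (k + 1), τ i))
      = signVar ((List.range m).map (fun k => ∑ i ∈ Finset.range (k + 1), τ i)) := by
    refine signVar_congr ?_
    rw [List.forall₂_map_left_iff, List.forall₂_map_right_iff, List.forall₂_same]
    intro k _
    exact signRel_of_posMul (pow_pos ha _) rfl
  have step2 := signVar_partialSums_map_le τ m
  have step3 : signVar ((List.range m).map τ) = signVar ((List.range m).map TS) := by
    refine signVar_congr ?_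
    rw [List.forall₂_map_left_iff, List.forall₂_map_right_iff, List.forall₂_same]
    intro k _
    rw [hτ]; simp only
    split_ifs with hk
    · subst hk; exact signRel_of_posMul (pow_pos hba0 _) rfl
    · refine signRel_of_posMul ?_ rfl
      obtain ⟨p, hp⟩ : ∃ p, u + k = p + 1 := ⟨u + k - 1, by omega⟩
      rw [hp, Nat.add_sub_cancel, pow_succ]
      nlinarith [pow_pos hba0 p, hba]
  have step4 := signVar_tailSums_map_le (fun k => B (u + k)) m
  have step5 : signVar ((List.range m).map (fun k => B (u + k))) = signVar ((List.range (w + 1 - u)).map (fun k => f.coeff (u + k))) := by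
    rw [← hm]
    refine signVar_congr ?_
    rw [List.forall₂_map_left_iff, List.forall₂_map_right_iff, List.forall₂_same]
    intro k hk
    have hkm := List.mem_range.mp hk
    -- `B (u+k)` has the strict sign of `c_{u+k}` whenever the latter is non-zero, and vanishes with it otherwise
    suffices hsign : (f.coeff (u + k) = 0 → B (u + k) = 0) ∧ (f.coeff (u + k) ≠ 0 → 0 < f.coeff (u + k) * B (u + k)) by
      by_cases h0 : f.coeff (u + k) = 0
      · rw [hsign.1 h0, h0]; exact ⟨Iff.rfl, Iff.rfl⟩
      · have hp := hsign.2 h0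
        rcases lt_or_gt_of_ne h0 with hneg | hpos
        · have : B (u + k) < 0 := by nlinarith
          exact ⟨⟨fun h => absurd this (not_lt.mpr h.le), fun h => absurd hneg (not_lt.mpr h.le)⟩,
            ⟨fun _ => hneg, fun _ => this⟩⟩
        · have : 0 < B (u + k) := by nlinarith
          exact ⟨⟨fun _ => hpos, fun _ => this⟩,
            ⟨fun h => absurd this (not_lt.mpr h.le), fun h => absurd hpos (not_lt.mpr h.le)⟩⟩
    -- junk bounds
    have hLo_le : |Lo * (a / b) ^ u| ≤ ∑ i ∈ Finset.range u, |f.coeff i| * a ^ i := by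
      rw [hLo, Finset.sum_mul]
      refine (Finset.abs_sum_le_sum_abs _ _).trans (Finset.sum_le_sum fun i hi => ?_)
      have hiu := Finset.mem_range.mp hi
      rw [hA]; simp only
      rw [abs_mul, abs_mul, abs_mul, abs_of_pos (pow_pos ha _), abs_of_pos (pow_pos hba0 _), abs_of_pos (pow_pos hab0 _)]
      have hle : (b / a) ^ i * (a / b) ^ u ≤ 1 := by
        obtain ⟨d, rfl⟩ := Nat.exists_eq_add_of_le hiu.le
        rw [pow_add, ← mul_assoc, ← mul_pow, div_mul_div_comm, mul_comm b a, div_self (mul_pos ha hb).ne', one_pow, one_mul]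
        exact pow_le_one₀ hab0.le hab1.le
      calc |f.coeff i| * a ^ i * (b / a) ^ i * (a / b) ^ u = |f.coeff i| * a ^ i * ((b / a) ^ i * (a / b) ^ u) := by ring
        _ ≤ |f.coeff i| * a ^ i * 1 := mul_le_mul_of_nonneg_left hle (by positivity)
        _ = |f.coeff i| * a ^ i := mul_one _
    have hHi_le : |Hi| ≤ ∑ i ∈ Finset.Ioc w n, |f.coeff i| * a ^ i := by
      rw [hHi]
      refine (Finset.abs_sum_le_sum_abs _ _).trans (Finset.sum_le_sum fun i _ => ?_)
      rw [hA]; simp only; rw [abs_mul, abs_of_pos (pow_pos ha _)]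
    have hHi_le' : |Hi| ≤ (a / b) ^ w * ∑ i ∈ Finset.Ioc w n, |f.coeff i| * b ^ i := by
      refine hHi_le.trans ?_
      rw [Finset.mul_sum]
      refine Finset.sum_le_sum fun i hi => ?_
      have hwi : w ≤ i := (Finset.mem_Ioc.mp hi).1.le
      -- `a^i ≤ (a/b)^w b^i`
      obtain ⟨d, rfl⟩ := Nat.exists_eq_add_of_le hwi
      have e1 : (a / b) ^ w * (|f.coeff (w + d)| * b ^ (w + d)) = |f.coeff (w + d)| * (a ^ w * b ^ d) := by
        rw [div_pow, pow_add]; field_simp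
      rw [e1, pow_add]
      exact mul_le_mul_of_nonneg_left (mul_le_mul_of_nonneg_left (pow_le_pow_left₀ ha.le hab.le d) (pow_nonneg ha.le _))
        (abs_nonneg _)
    constructor
    · intro h0
      -- then `u + k` is neither `u` nor `w`
      have hku : u + k ≠ u := fun h => hcu (by rw [← h]; exact h0)
      have hkw : u + k ≠ w := fun h => hcw (by rw [← h]; exact h0)
      rw [hB]; simp only; rw [if_neg hku, if_neg hkw, hA]; simp only; rw [h0]; ring
    · intro hne
      rw [hB]; simp only
      by_cases hk0 : k = 0
      · subst hk0
        simp only [add_zero] at hne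
        simp only [add_zero, if_true]
        -- `B u = A u + Lo (a/b)^u + [u = w] Hi`, junk below `|A u|` by dominance at `a`
        have hJ : |Lo * (a / b) ^ u + (if u = w then Hi else 0)| < |f.coeff u| * a ^ u := by
          have hT : ∑ i ∈ Finset.range u, |f.coeff i| * a ^ i + ∑ i ∈ Finset.Ioc w n, |f.coeff i| * a ^ i
              ≤ ∑ i ∈ f.support.erase u, |f.coeff i| * a ^ i := by
            have hdisj : Disjoint (Finset.range u) (Finset.Ioc w n) := by
              rw [Finset.disjoint_left]; intro i h1 h2; simp [Finset.mem_Ioc] at h1 h2; omega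
            rw [← Finset.sum_union hdisj]
            have hsub : Finset.range u ∪ Finset.Ioc w n = (Finset.range u ∪ Finset.Ioc w n).erase u := by
              rw [Finset.erase_eq_of_notMem]; simp [Finset.mem_Ioc]; omega
            rw [hsub]
            exact sum_erase_le_support f _ u (fun i => a ^ i) ha.le (fun i _ => ⟨pow_nonneg ha.le _, le_rfl⟩)
          by_cases huw' : u = w
          · rw [if_pos huw']
            calc |Lo * (a / b) ^ u + Hi| ≤ |Lo * (a / b) ^ u| + |Hi| := abs_add_le _ _
              _ ≤ _ := add_le_add hLo_le hHi_le
              _ ≤ _ := hT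
              _ < _ := hdomA
          · rw [if_neg huw', add_zero]
            calc |Lo * (a / b) ^ u| ≤ ∑ i ∈ Finset.range u, |f.coeff i| * a ^ i := hLo_le
              _ ≤ ∑ i ∈ Finset.range u, |f.coeff i| * a ^ i + ∑ i ∈ Finset.Ioc w n, |f.coeff i| * a ^ i :=
                  le_add_of_nonneg_right (Finset.sum_nonneg fun i _ => mul_nonneg (abs_nonneg _) (pow_nonneg ha.le _))
              _ ≤ _ := hT
              _ < _ := hdomA
        rw [hA]; simp only
        rw [abs_lt] at hJ
        have hau : 0 < a ^ u := pow_pos ha _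
        rcases lt_or_gt_of_ne hne with hneg | hpos
        · rw [abs_of_neg hneg] at hJ
          have : f.coeff u * (f.coeff u * a ^ u + Lo * (a / b) ^ u + (if u = w then Hi else 0))
              = (f.coeff u) ^ 2 * a ^ u + f.coeff u * (Lo * (a / b) ^ u + (if u = w then Hi else 0)) := by ring
          rw [this]; nlinarith [hJ.1, hJ.2, sq_nonneg (f.coeff u)]
        · rw [abs_of_pos hpos] at hJ
          have : f.coeff u * (f.coeff u * a ^ u + Lo * (a / b) ^ u + (if u = w then Hi else 0))
              = (f.coeff u) ^ 2 * a ^ u + f.coeff u * (Lo * (a / b) ^ u + (if u = w then Hi else 0)) := by ring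
          rw [this]; nlinarith [hJ.1, hJ.2, sq_nonneg (f.coeff u)]
      · have hku : u + k ≠ u := by omega
        rw [if_neg hku, add_zero]
        by_cases hkw : u + k = w
        · rw [if_pos hkw, hkw, hA]; simp only
          -- `B w = A w + Hi`, `|Hi| < |A w|` by dominance at `b`
          have hJ : |Hi| < |f.coeff w| * a ^ w := by
            have h1 : ∑ i ∈ Finset.Ioc w n, |f.coeff i| * b ^ i ≤ ∑ i ∈ f.support.erase w, |f.coeff i| * b ^ i := by
              have hsub : Finset.Ioc w n = (Finset.Ioc w n).erase w := by
                rw [Finset.erase_eq_of_notMem]; simp [Finset.mem_Ioc]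
              rw [hsub]
              exact sum_erase_le_support f _ w (fun i => b ^ i) hb.le (fun i _ => ⟨pow_nonneg hb.le _, le_rfl⟩)
            have haw : (a / b) ^ w * (|f.coeff w| * b ^ w) = |f.coeff w| * a ^ w := by
              rw [div_pow]; field_simp
            calc |Hi| ≤ (a / b) ^ w * ∑ i ∈ Finset.Ioc w n, |f.coeff i| * b ^ i := hHi_le'
              _ ≤ (a / b) ^ w * ∑ i ∈ f.support.erase w, |f.coeff i| * b ^ i :=
                  mul_le_mul_of_nonneg_left h1 (pow_nonneg hab0.le _)
              _ < (a / b) ^ w * (|f.coeff w| * b ^ w) := mul_lt_mul_of_pos_left hdomB (pow_pos hab0 _)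
              _ = _ := haw
          rw [hkw] at hne
          rw [abs_lt] at hJ
          have haw0 : 0 < a ^ w := pow_pos ha _
          rcases lt_or_gt_of_ne hne with hneg | hpos
          · rw [abs_of_neg hneg] at hJ
            have : f.coeff w * (f.coeff w * a ^ w + Hi) = (f.coeff w) ^ 2 * a ^ w + f.coeff w * Hi := by ring
            rw [this]; nlinarith [hJ.1, hJ.2]
          · rw [abs_of_pos hpos] at hJ
            have : f.coeff w * (f.coeff w * a ^ w + Hi) = (f.coeff w) ^ 2 * a ^ w + f.coeff w * Hi := by ring
            rw [this]; nlinarith [hJ.1, hJ.2]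
        · rw [if_neg hkw, add_zero, hA]; simp only
          have : f.coeff (u + k) * (f.coeff (u + k) * a ^ (u + k)) = (f.coeff (u + k)) ^ 2 * a ^ (u + k) := by ring
          rw [this]
          exact mul_pos (by positivity) (pow_pos ha _)
  calc signVar ((List.range m).map (fun k => a ^ (u + k) * ∑ i ∈ Finset.range (k + 1), τ i))
      = signVar ((List.range m).map (fun k => ∑ i ∈ Finset.range (k + 1), τ i)) := step1
    _ ≤ signVar ((List.range m).map τ) := step2
    _ = signVar ((List.range m).map TS) := step3
    _ ≤ signVar ((List.range m).map (fun k => B (u + k))) := step4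
    _ = _ := step5

end Summit.ValiantsHypothesis.ValiantsHypothesis.Theorems.KPlusLogSqLaw.LocalDescartes
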